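import Literature.AnabelianGeometry.SemiGraphs.TemperedCompactInVerticialFalseOfEscaping
import HarnessLib

/-!
# Escaping compact subgroups falsify [SemiAnbd] Thm 3.7 (iv) at a graph — the NEGATIVE-MODULO form

Mochizuki, *Semi-graphs of anabelioids*, Publ. RIMS **42** (2006), §3, Theorem 3.7 (iv), manuscript p. 41
[cite: MochizukiSemiAnbd2006, Thm 3.7(iv) p.41] ("the maximal compact subgroups of `π₁^temp(𝒢)` are
precisely the verticial subgroups").  The printed proof is for FINITE underlying semi-graphs (kernel:
`maximalCompactIffVerticialAt_of_finiteGraph`).  For the cell's ∀-countable typing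
`MaximalCompactIffVerticial` (FACT-LIST F-1750) the desk countermodel `𝒢_θ` of abc-iut-L3-d1 (memo
COUNTERMODEL-Thm37iii-infinite.md, addendum (ε); independently abc-iut-L3-t5's memo §6) gives a compact
`C` in no verticial subgroup and, by Zorn (abc-iut-w6-d120's `IsTempered.exists_isMaximalCompactSubgroup_ge`,
`TemperedMaximalCompactZorn.lean`), a MAXIMAL compact `K ⊇ C`, which is then not verticial.

This PROOF-ONLY file (abc-iut-L3-t5, programme SUBDAG-SemiAnbd-Thm37iii-REFUTE, seam lemma for R7; no
definition, nothing constructed) is the (iv)-analogue of abc-iut-L3-t6's R0 file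
`TemperedCompactInVerticialFalseOfEscaping.lean`: over the level data `D : VerticialLevelData 𝒢 c`, if a
subgroup `C` fixes NO compatible vertex system (`hesc`, verbatim as in R0) and lies in a maximal compact
subgroup `K`, then `K` is not verticial (`not_exists_verticial_of_le_of_escaping`), so
`MaximalCompactIffVerticialAt 𝒢` fails at the chart `c` (`not_maximalCompactIffVerticialAt_of_escaping`)
and with it the ∀-countable named fact (`not_maximalCompactIffVerticial_of_escaping`).
Nothing here bears on [IUTchIII] Cor. 3.12 (IUT uses finite dual graphs).
-/

namespace Literature.AnabelianGeometry.SemiGraphs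

namespace ProfiniteSemiGraph

namespace VerticialLevelData

universe v u

variable {𝒢 : ProfiniteSemiGraph.{u}} {c : TemperedPiChart 𝒢} (D : VerticialLevelData.{v} 𝒢 c)

/-- A subgroup containing an escaping subgroup lies in no verticial subgroup (in particular is not one).
[cite: MochizukiSemiAnbd2006, Thm 3.7(iv) p.41] -/
theorem not_exists_verticial_of_le_of_escaping (C K : Subgroup c.G) (hCK : C ≤ K)
    (hesc : ∀ x : ∀ j, (D.tree j).Vertex, (∀ ⦃i j : D.J⦄ (h : i ≤ j), (D.trans h).vertexMap (x j) = x i) →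
      ∃ g ∈ C, ∃ j, (D.act j g).hom.vertexMap (x j) ≠ x j) :
    ¬ ∃ (v : 𝒢.graph.Vertex) (H : Subgroup c.G), H ∈ verticialSubgroups c v ∧ K ≤ H := by
  rintro ⟨v, H, hH, hKH⟩
  exact D.not_exists_verticial_of_escaping C hesc ⟨v, H, hH, hCK.trans hKH⟩

/-- **An escaping subgroup inside a MAXIMAL compact subgroup falsifies `MaximalCompactIffVerticialAt 𝒢`**
([SemiAnbd] Thm 3.7 (iv) at `𝒢`, clause «maximal compact ⇒ verticial», at the chart `c`).  NEGATIVE-MODULO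
form: no such `(𝒢, c, D, C, K)` is constructed here; the maximal compact `K ⊇ C` is the Zorn input
(`IsTempered.exists_isMaximalCompactSubgroup_ge`). [cite: MochizukiSemiAnbd2006, Thm 3.7(iv) p.41] -/
theorem not_maximalCompactIffVerticialAt_of_escaping (h37 : 𝒢.Thm37Hypotheses) (C K : Subgroup c.G)
    (hK : IsMaximalCompactSubgroup K) (hCK : C ≤ K)
    (hesc : ∀ x : ∀ j, (D.tree j).Vertex, (∀ ⦃i j : D.J⦄ (h : i ≤ j), (D.trans h).vertexMap (x j) = x i) →
      ∃ g ∈ C, ∃ j, (D.act j g).hom.vertexMap (x j) ≠ x j) :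
    ¬ MaximalCompactIffVerticialAt 𝒢 := fun hMV => by
  obtain ⟨v, hv⟩ := ((hMV h37 c).1 K).mp hK
  exact D.not_exists_verticial_of_le_of_escaping C K hCK hesc ⟨v, K, hv, le_rfl⟩

/-- … and hence falsifies the ∀-countable named fact `MaximalCompactIffVerticial` ([SemiAnbd] Thm 3.7 (iv)
as typed for ALL countable semi-graphs; finite graphs are settled positively by
`maximalCompactIffVerticialAt_of_finiteGraph`). NEGATIVE-MODULO form.
[cite: MochizukiSemiAnbd2006, Thm 3.7(iv) p.41] -/
theorem not_maximalCompactIffVerticial_of_escaping (h37 : 𝒢.Thm37Hypotheses) (C K : Subgroup c.G)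
    (hK : IsMaximalCompactSubgroup K) (hCK : C ≤ K)
    (hesc : ∀ x : ∀ j, (D.tree j).Vertex, (∀ ⦃i j : D.J⦄ (h : i ≤ j), (D.trans h).vertexMap (x j) = x i) →
      ∃ g ∈ C, ∃ j, (D.act j g).hom.vertexMap (x j) ≠ x j) :
    ¬ MaximalCompactIffVerticial.{u} := fun hMV =>
  D.not_maximalCompactIffVerticialAt_of_escaping h37 C K hK hCK hesc
    (maximalCompactIffVerticial_iff_forall_at.mp hMV 𝒢)

/-- The form the assembly uses: an escaping COMPACT `C` together with the Zorn principle «every compact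
subgroup lies in a maximal compact subgroup» (binder `hzorn`, discharged at the canonical chart of `𝒢_θ`
by `IsTempered.exists_isMaximalCompactSubgroup_ge`) falsifies `MaximalCompactIffVerticial`.
NEGATIVE-MODULO form. [cite: MochizukiSemiAnbd2006, Thm 3.7(iv) p.41] -/
theorem not_maximalCompactIffVerticial_of_escaping_of_zorn (h37 : 𝒢.Thm37Hypotheses) (C : Subgroup c.G)
    (hC : IsCompact (C : Set c.G))
    (hzorn : ∀ C' : Subgroup c.G, IsCompact (C' : Set c.G) →
      ∃ K : Subgroup c.G, IsMaximalCompactSubgroup K ∧ C' ≤ K)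
    (hesc : ∀ x : ∀ j, (D.tree j).Vertex, (∀ ⦃i j : D.J⦄ (h : i ≤ j), (D.trans h).vertexMap (x j) = x i) →
      ∃ g ∈ C, ∃ j, (D.act j g).hom.vertexMap (x j) ≠ x j) :
    ¬ MaximalCompactIffVerticial.{u} := by
  obtain ⟨K, hK, hCK⟩ := hzorn C hC
  exact D.not_maximalCompactIffVerticial_of_escaping h37 C K hK hCK hesc

end VerticialLevelData

end ProfiniteSemiGraph

end Literature.AnabelianGeometry.SemiGraphs
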